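import Summits.Ventures.PercRepro.RankLevelSetLevelSixGiantSCoreSmall
import Summits.Ventures.PercRepro.RankLevelSetLevelSixGiantSCoreBig
import Summits.Ventures.PercRepro.RankLevelSetLevelFiveMult
import Summits.Ventures.PercRepro.S3SixWindow
import Summits.Ventures.PercRepro.RankLevelSetCoreSixFiftyTwo

/-!
# PercRepro — THEOREM C₆, THE GIANT-FLAT COUNT WITH THE EMPTY BIG CLASS: C-025 AT LEVEL `6` FOR EVERY FINITE
MATROID AND EVERY `p ≥ 165` (p8, S3)

`proofs/SUBCLAIM-S3-p8.md` §3d. The giant-flat assembly of RankLevelSetLevelSixGiant with one more observation: at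
corank `d ≤ 16` a rank-`6` closure of the `e`-free core has `≤ 6 + d ≤ 22 = f(5) + 1` points, so every pair of the
split count is SMALL and the `U`-count is `ncard_eRk_eq_ncard_le_le_small` (RankLevelSetDepCountGiantS) — the
binding coranks of the giant-flat count lose their big terms. The polynomial inequalities
`level_six_poly_giantS_small` (`7 ≤ d ≤ 16`) and `level_six_poly_giantS` (`17 ≤ d ≤ 50`, the three-term form)
hold from `p ≥ 165` (`164` fails at `d = 16`; the core cells are RankLevelSetLevelSixGiantSCoreSmall / CoreBig):
* `c025_core_six_bounded_corank_giantS (165 ≤ p) (7 ≤ d ≤ 50)` — the core cells;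
* `c025_six_of_five_giantS` (level `5` for all `p ≥ 165` ⇒ level `6` for all `p ≥ 166`), `c025_six_large_giantS'`
  (`836 ≤ p`, over THEOREM C₅), **`c025_six_large_giantS'' (166 ≤ p)`** on p7's level-`5` row
  `c025_five_large_mult (83 ≤ p)` (RankLevelSetLevelFiveMult);
* **`c025_six_large_one_sixty_five (165 ≤ p) : RLS M p 6`** — rank `165` by the per-rank wrapper
  (`rls_six_at_of_core`, S3SixWindow) on level `5` at `164` and the core theorems; plus the `C025`-body spelling;
* `rls_six_at_of_open_cells_S` / `s3Window_of_cells_S` — the open content of S3 after this chain: the `(8, 6)` cell,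
  level `5` on `8 ≤ p ≤ 82`, the band `(p₀, 7 ≤ d ≤ 50)` for `9 ≤ p₀ ≤ 164`, `(p₀, d ≥ 51)` for `p₀ ≤ 51`.
Axioms: standard.
-/

open scoped Matroid

namespace PercRepro

namespace ThmN

open Set

variable {α : Type}

/-- **The `e`-free core at level `6`, corank `7 ≤ d ≤ 50`, rank `p ≥ 165`** (the giant-flat count, big class empty
at `d ≤ 16`). -/
theorem c025_core_six_bounded_corank_giantS (M : Matroid α) [M.Finite] (p d : ℕ) (hp : 165 ≤ p) (hd7 : 7 ≤ d)
    (hd50 : d ≤ 50) (hR : M.eRank = (p : ℕ∞)) (hn : M.E.ncard = p + d)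
    (hfree : ∀ e ∈ M.E, ∃ A ⊆ M.E \ {e}, e ∉ M.closure A ∧ e ∉ M.closure ((M.E \ {e}) \ A)) :
    RLS M p 6 := by
  rcases Nat.lt_or_ge d 17 with hd16 | hd17
  · exact c025_core_six_bounded_corank_giantS_small M p d hp hd7 (by omega) hR hn hfree
  · exact c025_core_six_bounded_corank_giantS_big M p d hp hd17 hd50 hR hn hfree

/-- **THEOREM C₆, THE GIANT-FLAT COUNT WITH THE EMPTY BIG CLASS, GIVEN LEVEL `5`**: level `5` for all `p ≥ 165`
implies level `6` for all `p ≥ 166`. -/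
theorem c025_six_of_five_giantS (h5 : ∀ (M : Matroid α) [M.Finite] (p : ℕ), 165 ≤ p → RLS M p 5) :
    ∀ (M : Matroid α) [M.Finite] (p : ℕ), 166 ≤ p → RLS M p 6 := by
  intro M _ p hp
  refine rls_succ_large (α := α) 5 6 165 ?_ ?_ ?_ M p hp (by omega)
  · intro M' _ p' hP _
    exact h5 M' p' (by omega)
  · intro M' _ p' _ hn _
    rcases Nat.lt_or_ge M'.E.ncard (p' + 6) with h | h
    · exact RLS_of_ncard_lt M' h
    · exact RLS_of_ncard_eq M' (by omega)
  · intro M' _ p' hP hR hbig _ hfree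
    rcases Nat.lt_or_ge M'.E.ncard (p' + 51) with h | h
    · exact c025_core_six_bounded_corank_giantS M' p' (M'.E.ncard - p') hP (by omega) (by omega) hR (by omega) hfree
    · exact c025_core_six_fortythree M' p' (by omega) hR (by omega) hfree

/-- **Unconditional over the tree of record** (THEOREM C₅ at `835`): C-025 at level `6` for every `p ≥ 836`. -/
theorem c025_six_large_giantS' (M : Matroid α) [M.Finite] (p : ℕ) (hp : 836 ≤ p) : RLS M p 6 := by
  refine rls_succ_large (α := α) 5 6 835 ?_ ?_ ?_ M p hp (by omega)
  · intro M' _ p' hP _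
    exact c025_five_large M' p' hP
  · intro M' _ p' _ hn _
    rcases Nat.lt_or_ge M'.E.ncard (p' + 6) with h | h
    · exact RLS_of_ncard_lt M' h
    · exact RLS_of_ncard_eq M' (by omega)
  · intro M' _ p' hP hR hbig _ hfree
    rcases Nat.lt_or_ge M'.E.ncard (p' + 51) with h | h
    · exact c025_core_six_bounded_corank_giantS M' p' (M'.E.ncard - p') (by omega) (by omega) (by omega) hR (by omega)
        hfree
    · exact c025_core_six_fortythree M' p' (by omega) hR (by omega) hfree

/-- **C-025 at level `6` for every `p ≥ 166`, unconditional**: `c025_six_of_five_giantS` on p7's level-`5` row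
`c025_five_large_mult (83 ≤ p)`. -/
theorem c025_six_large_giantS'' (M : Matroid α) [M.Finite] (p : ℕ) (hp : 166 ≤ p) : RLS M p 6 :=
  c025_six_of_five_giantS (fun M _ p hp => c025_five_large_mult M p (by omega)) M p hp

/-- **THEOREM C₆ AT `165`**: C-025 at level `6` for every `p ≥ 165`, every finite matroid, unconditional — rank `165`
by the per-rank wrapper on level `5` at `164` (p7's row) and the core theorems, `p ≥ 166` by `c025_six_large_giantS''`. -/
theorem c025_six_large_one_sixty_five (M : Matroid α) [M.Finite] (p : ℕ) (hp : 165 ≤ p) : RLS M p 6 := by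
  rcases Nat.lt_or_ge p 166 with hlt | hge
  · have h165 : p = 165 := by omega
    subst h165
    refine rls_six_at_of_core 165 (by norm_num) (fun M _ => c025_five_large_mult M 164 (by norm_num)) ?_ M
    intro M _ d hd hR hn hfree
    rcases Nat.lt_or_ge d 51 with hd50 | hd51
    · exact c025_core_six_bounded_corank_giantS M 165 d (by norm_num) hd (by omega) hR hn hfree
    · exact c025_core_six_fortythree_fiftytwo M 165 (by norm_num) hR (by omega) hfree
  · exact c025_six_large_giantS'' M p hge

/-- The same in the vocabulary of `C025`: the level-`6` frontier of the counting route is every `p ≥ 165`. -/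
theorem c025_six_large_one_sixty_five' (M : Matroid α) [M.Finite] (p : ℕ) (hp : 165 ≤ p) :
    phiK p 6 * ({A : Set α | A ⊆ M.E ∧ M.eRk A = (p : ℕ∞) ∧ M.eRk (M.E \ A) = (6 : ℕ∞)}.ncard : ℚ) ≤
      ({A : Set α | A ⊆ M.E ∧ (6 : ℕ∞) < M.eRk A ∧ M.eRk A < (p : ℕ∞)}.ncard : ℚ) :=
  c025_six_large_one_sixty_five M p hp

/-- **The open cells of S3 at rank `p₀` after this chain**: level `6` at `p₀ ≥ 9` ⇐ level `5` at `p₀ − 1` + the core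
cells `(p₀, 7 ≤ d ≤ 50)` when `p₀ < 165` + `(p₀, d ≥ 51)` when `p₀ < 52`. -/
theorem rls_six_at_of_open_cells_S (p₀ : ℕ) (hp : 9 ≤ p₀)
    (h5 : ∀ (M : Matroid α) [M.Finite], RLS M (p₀ - 1) 5)
    (hmid : ∀ (M : Matroid α) [M.Finite] (d : ℕ), 7 ≤ d → d ≤ 50 → p₀ < 165 →
      M.eRank = (p₀ : ℕ∞) → M.E.ncard = p₀ + d → EFree M → RLS M p₀ 6)
    (hbig : ∀ (M : Matroid α) [M.Finite] (d : ℕ), 51 ≤ d → p₀ < 52 →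
      M.eRank = (p₀ : ℕ∞) → M.E.ncard = p₀ + d → EFree M → RLS M p₀ 6) :
    ∀ (M : Matroid α) [M.Finite], RLS M p₀ 6 := by
  refine rls_six_at_of_core p₀ hp h5 ?_
  intro M _ d hd hR hn hfree
  rcases Nat.lt_or_ge d 51 with hd50 | hd51
  · rcases Nat.lt_or_ge p₀ 165 with hsmall | hlarge
    · exact hmid M d hd (by omega) hsmall hR hn hfree
    · exact c025_core_six_bounded_corank_giantS M p₀ d hlarge hd (by omega) hR hn hfree
  · rcases Nat.lt_or_ge p₀ 52 with hsmall | hlarge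
    · exact hbig M d hd51 hsmall hR hn hfree
    · exact c025_core_six_fortythree_fiftytwo M p₀ hlarge hR (by omega) hfree

end ThmN

/-- **The open content of S3 after this chain, exactly**: the `(8, 6)` cell, level `5` on `8 ≤ p ≤ 82` (p7's
`c025_five_large_mult` covers `p ≥ 83`), the bounded-corank band `(p₀, 7 ≤ d ≤ 50)` for `9 ≤ p₀ ≤ 164`, and
`(p₀, d ≥ 51)` for `p₀ ≤ 51`; everything else is a tree theorem (`p ≥ 165` is `c025_six_large_one_sixty_five`). -/
theorem s3Window_of_cells_S
    (h86 : ∀ {α : Type} (M : Matroid α) [M.Finite], ThmN.RLS M 8 6)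
    (h5 : ∀ {α : Type} (M : Matroid α) [M.Finite] (p : ℕ), 8 ≤ p → p ≤ 82 → ThmN.RLS M p 5)
    (hmid : ∀ {α : Type} (M : Matroid α) [M.Finite] (p₀ d : ℕ), 9 ≤ p₀ → p₀ < 165 → 7 ≤ d → d ≤ 50 →
      M.eRank = (p₀ : ℕ∞) → M.E.ncard = p₀ + d → ThmN.EFree M → ThmN.RLS M p₀ 6)
    (hbig : ∀ {α : Type} (M : Matroid α) [M.Finite] (p₀ d : ℕ), 9 ≤ p₀ → p₀ < 52 → 51 ≤ d →
      M.eRank = (p₀ : ℕ∞) → M.E.ncard = p₀ + d → ThmN.EFree M → ThmN.RLS M p₀ 6) :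
    S3Window := by
  intro α M _ p hp8 hp
  rcases Nat.lt_or_ge p 9 with h8 | h9
  · have : p = 8 := by omega
    subst this
    exact h86 M
  · rcases Nat.lt_or_ge p 165 with hlt | hge
    · refine ThmN.rls_six_at_of_open_cells_S (α := α) p h9 ?_
        (fun M _ d hd hd50 hsm hR hn hf => hmid M p d h9 hsm hd hd50 hR hn hf)
        (fun M _ d hd51 hsm hR hn hf => hbig M p d h9 hsm hd51 hR hn hf) M
      intro M _
      rcases Nat.lt_or_ge (p - 1) 83 with hlt5 | hge5
      · exact h5 M (p - 1) (by omega) (by omega)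
      · exact ThmN.c025_five_large_mult M (p - 1) hge5
    · exact ThmN.c025_six_large_one_sixty_five M p hge

end PercRepro
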